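import Summits.Langlands.Langlands.Theses.ExteriorSquareAscent
import Literature.NumberTheory.Automorphic.AsgariRaghuramExteriorSquareCuspidal
import Literature.NumberTheory.Automorphic.BockleHuiIrreducibleGL3AnalyticProofs
import Literature.NumberTheory.Automorphic.ClassFieldCharacterFrobenius
import Literature.NumberTheory.Automorphic.QuadraticCharacterTwist
import Literature.NumberTheory.GaloisRepresentations.HeckeCharacterGaloisAvatarProofs
import Literature.NumberTheory.GaloisRepresentations.GlobalArtinMapAbstractExtensionProofs
import Literature.NumberTheory.GaloisRepresentations.GlobalReciprocityCyclicDescentProofs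
import Literature.NumberTheory.Automorphic.SatakeParamNeZeroProofs
import Literature.NumberTheory.Automorphic.AutomorphicRepsGLSatakeFlathProofs
import Literature.NumberTheory.GaloisRepresentations.HeckeCharacterWeakApproximation

/-!
# Stub `stub_wedgeTwoCuspidal` of line `Sketch` for crux stmt-Langlands-18054
(`Summit.Langlands.Langlands.Theses.ExteriorSquareAscent.ReducibleInducesSquare`)

The CUSPIDAL exterior square of a cuspidal `π` on `GL₄(𝔸_K)` which is neither essentially self-dual
nor quadratically self-twisted at Satake level, granting the named fact
`AsgariRaghuram2007_selfDual_or_selfTwist_of_wedgeTwo_not_cuspidal` (Asgari–Raghuram 2007, Thm. 1,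
(i) ⇒ (iii), Satake form; a HYPOTHESIS here): a cuspidal datum `P6` on `GL₆(𝔸_K)` with
`t_{P6,v} = ∧² t_{π,v}` (`wedgeTwoParams`) at almost every finite place `v`.

By contraposition of the named fact (instantiated at `hF m := isCompact_glFiniteIntegralLevel_holds m K`;
`hF 4`, `hF 6` agree with the crux's `hcpt`, `h6` by proof irrelevance) it suffices to refute its two
disjuncts from the crux's two `¬` hypotheses:

* (α) `t_{π,v}⁻¹ = χ(ϖ_v) t_{π,v}` a.e. for a Hecke character `χ`: the `GL(1)` datum of `χ`
  (`exists_cuspidal_glOne_hasSatakeParamAt_valueAtUniformizer`, Satake parameter `{χ(ϖ_v)}` a.e.)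
  witnesses essential self-duality — excluded;
* (β) `ξ(ϖ_v) t_{π,v} = t_{π,v}` a.e. for a Hecke character `ξ ≠ 1`: taking products (the Satake
  eigenvalues are non-zero, `hasSatakeParamAt_ne_zero_holds`, and `π` is unramified a.e.,
  `AutomorphicRepData.hasSatakeParamAt_cofinite_holds`) `ξ(ϖ_v)⁴ = 1` a.e., so `ξ⁴ = 1` by rigidity
  of Hecke characters (`HeckeCharacter.eq_one_of_eventually_valueAtUniformizer_eq_one`); hence `ξ` or
  `ξ²` is a character `δ ≠ 1` with `δ² = 1` still self-twisting `π`; global CFT for quadratic characters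
  (`HeckeCharacter.exists_quadratic_isClassFieldCharacter`, PROVED in the tree) makes `δ` the class-field
  character of a quadratic `L/K`, and `δ(ϖ_v) = ε_{L/K}(v)` a.e.
  (`IsClassFieldCharacter.eventually_isPrimitiveRoot_valueAtUniformizer`,
  `valueAtUniformizer_eq_quadraticSign_of_orderOf`), so `t_{π,v}` is `ε_{L/K}(v)`-stable a.e. —
  excluded by the crux's quadratic non-self-twist hypothesis (whose inline sign IS `quadraticSign L v`).

The CFT step (a Hecke character `δ` with `δ² = 1 ≠ δ` is the class-field character of a quadratic
`L/K`, hence `δ(ϖ_v) = ε_{L/K}(v)` a.e.: `exists_quadratic_eventually_valueAtUniformizer_eq_quadraticSign`)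
re-runs the argument of the tree's `HeckeCharacter.exists_quadratic_isClassFieldCharacter`
(`Literature/NumberTheory/Automorphic/QuadraticSelfTwistClassFieldProofs.lean`). That module cannot be
imported by this line: it and `RamakrishnanBoxTimesProofs` — in the import closure of
`BockleHuiIrreducibleGL3AnalyticProofs`, which the line's skeleton and its analytic stubs import — both
declare `Literature.NumberTheory.Automorphic.isSatakeSelfTwist_iff_exists_isQuadraticSelfTwistAE`, so no
file can import both.
-/

set_option linter.dupNamespace false -- `Summit.Langlands.Langlands` is the mandated namespace

noncomputable section

namespace Summit.Langlands.Langlands.Cruxes.ReducibleInducesSquare.Sketch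

open Literature.NumberTheory.GaloisRepresentations Literature.NumberTheory.Automorphic
open NumberField IsDedekindDomain Filter
open scoped Classical MatrixGroups NumberField

/-! ### CFT: a quadratic idele-group character is the character of a quadratic extension
(adapted verbatim from `QuadraticSelfTwistClassFieldProofs`, see the module docstring) -/

section CFT

variable {F : Type} [Field F] [NumberField F]

/-- `-1 ≠ 1` in `ℂˣ`. [folklore] -/
private theorem neg_one_ne_one_units : (-1 : ℂˣ) ≠ 1 := by
  intro h
  have h' := congrArg Units.val h
  norm_num at h'

/-- In `ℂˣ`, `u² = 1` forces `u = 1` or `u = -1`. [folklore] -/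
private theorem eq_one_or_eq_neg_one_of_sq_eq_one {u : ℂˣ} (hu : u ^ 2 = 1) : u = 1 ∨ u = -1 := by
  have h : ((u : ℂ)) * (u : ℂ) = 1 := by
    rw [← pow_two, ← Units.val_pow_eq_pow_val, hu, Units.val_one]
  rcases mul_self_eq_one_iff.mp h with h' | h'
  · exact Or.inl (Units.val_eq_one.mp h')
  · refine Or.inr (Units.val_inj.mp ?_)
    rw [h', Units.val_neg, Units.val_one]

-- steps (1)–(5) adapted from `HeckeCharacter.exists_quadratic_isClassFieldCharacter`
-- (Literature/NumberTheory/Automorphic/QuadraticSelfTwistClassFieldProofs.lean, not importable here)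
/-- **A Hecke character of order two is the quadratic sign of a quadratic extension at almost every
place** (Tate, Cassels–Fröhlich Ch. VII §5.1 Main Theorem (B), (D), for characters of order `2`, with
Arthur–Clozel's "`ζ_v = η(ϖ_v)` is a root of unity of order `f_v`"). For a Hecke character `δ` of the
number field `F` with `δ² = 1` and `δ ≠ 1` there is a quadratic extension `K/F` with
`δ(ϖ_v) = ε_{K/F}(v)` (`quadraticSign K v`: `+1` at the places split in `K`, `-1` at the inert ones)
for almost all `v`. Steps (1)–(5) are the argument of the tree's
`HeckeCharacter.exists_quadratic_isClassFieldCharacter` (tree CFT, all theorems): `δ = χ ∘ ψ_{L/F}` for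
a finite abelian `L ⊆ F̄` and a character `χ` of `Gal(L/F)`
(`HeckeCharacter.exists_eq_charHecke_of_isFiniteOrder`); as `ψ_{L/F}` is onto, `χ² = 1 ≠ χ`,
`H = ker χ` has index `2` and `K = L^H` is quadratic over `F`; for `v` unramified in `L`,
`δ(ϖ_v) = χ(Frob_v)` and `Frob_v^{f_v(K)}` lies in `H`, so `δ ∘ N_{K/F}` is `1` at almost every
uniformizer of `K`, hence trivial; thus `δ` kills `F^× N(𝔸_K^×)`, of index `[K : F] = 2`, and
`δ ≠ 1` gives `ker δ = F^× N(𝔸_K^×)` (`IsClassFieldCharacter`). Step (6): such a character takes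
the value a primitive `f_v`-th root of unity at almost every `v`
(`IsClassFieldCharacter.eventually_isPrimitiveRoot_valueAtUniformizer`), i.e. `ε_{K/F}(v)` at the
unramified places (`valueAtUniformizer_eq_quadraticSign_of_orderOf`).
[cite: CasselsFrohlichANT1967, Ch. VII §5.1 Main Theorem (B), (D) and §4.2 Corollary (iii)]
[cite: ArthurClozelAMS120, Ch. 3, proof of Thm. 3.1 (p. 172) and §4 (before Thm. 4.2)] -/
theorem exists_quadratic_eventually_valueAtUniformizer_eq_quadraticSign
    (δ : HeckeCharacter F) (hδ2 : δ ^ 2 = 1) (hδ1 : δ ≠ 1) :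
    ∃ (K : Type) (_ : Field K) (_ : NumberField K) (_ : Algebra F K),
      Module.finrank F K = 2 ∧
        ∀ᶠ v : HeightOneSpectrum (𝓞 F) in cofinite, δ.valueAtUniformizer v = quadraticSign K v := by
  classical
  have hfo : δ.IsFiniteOrder := isOfFinOrder_iff_pow_eq_one.mpr ⟨2, two_pos, hδ2⟩
  obtain ⟨L, hLfd, hLab, χ, hδχ⟩ := δ.exists_eq_charHecke_of_isFiniteOrder hfo
  haveI : NumberField L := NumberField.of_module_finite F L
  -- (1) `χ² = 1`, `χ ≠ 1`: values `±1`, and an element `g₀` with `χ g₀ = -1`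
  have hχsq : ∀ g : L ≃ₐ[F] L, χ g ^ 2 = 1 := fun g => by
    obtain ⟨x, rfl⟩ := artinIdeleMap_surjective L artinReciprocity_character_holds g
    rw [apply_artinIdeleMap, ← hδχ, ← HeckeCharacter.pow_apply, hδ2, HeckeCharacter.one_apply]
  have hχ1 : χ ≠ 1 := by
    rintro rfl
    exact hδ1 (hδχ.trans (charHecke_one L artinReciprocity_character_holds))
  obtain ⟨g₀, hg₀⟩ : ∃ g₀ : L ≃ₐ[F] L, χ g₀ ≠ 1 := by
    by_contra h
    push Not at h
    exact hχ1 (MonoidHom.ext h)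
  have hval : ∀ g : L ≃ₐ[F] L, χ g = 1 ∨ χ g = -1 := fun g =>
    eq_one_or_eq_neg_one_of_sq_eq_one (hχsq g)
  have hg₀' : χ g₀ = -1 := (hval g₀).resolve_left hg₀
  -- (2) the quadratic field `K = L^{ker χ}`
  set H : Subgroup (L ≃ₐ[F] L) := χ.ker with hHdef
  have hHidx : H.index = 2 := by
    refine Subgroup.index_eq_two_iff.mpr ⟨g₀, fun b => ?_⟩
    change Xor (b * g₀ ∈ χ.ker) (b ∈ χ.ker)
    rw [MonoidHom.mem_ker, MonoidHom.mem_ker, map_mul, hg₀']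
    rcases hval b with hb | hb
    · rw [hb, one_mul]
      exact Or.inr ⟨rfl, neg_one_ne_one_units⟩
    · rw [hb, neg_mul_neg, one_mul]
      exact Or.inl ⟨rfl, neg_one_ne_one_units⟩
  set K : IntermediateField F L := IntermediateField.fixedField H with hKdef
  haveI : NumberField K := NumberField.of_module_finite F K
  have hK2 : Module.finrank F K = 2 := by
    have h1 : Module.finrank K L = Nat.card H := IntermediateField.finrank_fixedField_eq_card H
    have h2 := Module.finrank_mul_finrank F K L
    have h3 : Nat.card (L ≃ₐ[F] L) = Module.finrank F L := IsGalois.card_aut_eq_finrank F L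
    have h4 : Nat.card H * H.index = Nat.card (L ≃ₐ[F] L) := Subgroup.card_mul_index H
    have hH0 : Nat.card H ≠ 0 := Nat.card_pos.ne'
    rw [h1, ← h3, ← h4, hHidx] at h2
    exact mul_right_cancel₀ hH0 (h2.trans (mul_comm _ _))
  -- (3) `Frob_v^{f_v(K)} ∈ H` at the places unramified in `K`
  have hkey : ∀ v : HeightOneSpectrum (𝓞 F), Algebra.IsUnramifiedIn (𝓞 K) v.asIdeal →
      galFrob F L v ^ v.asIdeal.inertiaDegIn (𝓞 K) ∈ H := by
    intro v hvK
    obtain ⟨Q, hQ, hφ⟩ := galFrob_spec F L v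
    haveI := hQ.1
    haveI := hQ.2
    haveI : v.asIdeal.IsMaximal := v.isMaximal
    haveI : IsGaloisGroup (K ≃ₐ[F] K) (𝓞 F) (𝓞 K) := IsGaloisGroup.of_isFractionRing _ _ _ F K
    have hf : v.asIdeal.inertiaDegIn (𝓞 K) = (Q.under (𝓞 K)).inertiaDeg (𝓞 F) :=
      Ideal.inertiaDegIn_eq_inertiaDeg v.asIdeal (Q.under (𝓞 K)) (K ≃ₐ[F] K)
    have hmem : galFrob F L v ^ (Q.under (𝓞 K)).inertiaDeg (𝓞 F) ∈
        (AlgEquiv.restrictNormalHom (F := F) (K₁ := L) K).ker :=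
      restrictNormalHom_pow_inertiaDeg_eq_one (K := F) (E := K) (M' := L) hvK hQ hφ
    rw [IntermediateField.restrictNormalHom_ker, hKdef, IntermediateField.fixingSubgroup_fixedField]
      at hmem
    rw [hf]
    exact hmem
  -- (4) `δ ∘ N_{K/F} = 1`
  have hunrL : ∀ᶠ v : HeightOneSpectrum (𝓞 F) in cofinite, Algebra.IsUnramifiedIn (𝓞 L) v.asIdeal :=
    eventually_isUnramifiedIn L
  have hunrK : ∀ᶠ v : HeightOneSpectrum (𝓞 F) in cofinite,
      Algebra.IsUnramifiedIn (𝓞 K) v.asIdeal := by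
    rw [eventually_cofinite]
    exact finite_setOf_not_isUnramifiedIn F K
  have hcomp : HeckeCharacter.compRelNorm K δ = 1 := by
    refine HeckeCharacter.eq_one_of_eventually_valueAtUniformizer_eq_one ?_
    have hT := (HeightOneSpectrum.tendsto_under_cofinite (𝓞 F) (B := 𝓞 K)).eventually
      (hunrL.and hunrK)
    filter_upwards [hT] with w hw
    obtain ⟨hvL, hvK⟩ := hw
    have hδunr : δ.IsUnramifiedAt (w.under (𝓞 F)) := by
      rw [hδχ]
      exact charHecke_isUnramifiedAt L χ artinReciprocity_character_holds hvL
    rw [δ.compRelNorm_valueAtUniformizer (E := K) rfl hvK hδunr,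
      ramificationIdxIn_eq_one_of_isUnramifiedIn hvK, one_mul]
    have hδv : ((δ (localUnits (w.under (𝓞 F))
        (HeckeCharacter.uniformizer F (w.under (𝓞 F)))) : ℂˣ) : ℂ) =
        ((χ (galFrob F L (w.under (𝓞 F))) : ℂˣ) : ℂ) := by
      rw [← charHecke_valueAtUniformizer L χ artinReciprocity_character_holds hvL, hδχ]
      rfl
    rw [hδv, ← Units.val_pow_eq_pow_val, ← map_pow, (MonoidHom.mem_ker).mp (hkey _ hvK),
      Units.val_one]
  -- (5) `δ` kills the norm group, of index `2`, and `δ ≠ 1`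
  have htriv : δ.IsTrivialOnNormGroup K :=
    (δ.isTrivialOnNormGroup_iff_forall_ideleRelNorm K).mpr fun y => by
      have h := congrArg (fun ω : HeckeCharacter K => ω y) hcomp
      simpa only [HeckeCharacter.compRelNorm_apply, HeckeCharacter.one_apply] using h
  have hidx : (normGroup F K).index = 2 := by
    rw [index_normGroup_eq_finrank_abstract F K artinReciprocity_character_holds, hK2]
  have hδK : δ.IsClassFieldCharacter K := by
    refine fun x => ⟨fun hx => ?_, htriv x⟩
    by_contra hxN
    refine hδ1 (HeckeCharacter.ext fun y => ?_)
    rw [HeckeCharacter.one_apply]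
    by_cases hy : y ∈ normGroup F K
    · exact htriv y hy
    · have hmem : x⁻¹ * y ∈ normGroup F K := by
        rw [Subgroup.mul_mem_iff_of_index_two hidx]
        exact iff_of_false (fun h => hxN ((Subgroup.inv_mem_iff _).mp h)) hy
      have h := htriv _ hmem
      rwa [map_mul, map_inv, hx, inv_one, one_mul] at h
  -- (6) `δ(ϖ_v)` is a primitive `f_v`-th root of unity, i.e. `ε_{K/F}(v)`, at almost every `v`
  haveI : FiniteDimensional F K := Module.finite_of_finrank_eq_succ hK2
  haveI : Algebra.IsQuadraticExtension F K := ⟨hK2⟩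
  have hprime : (Module.finrank F K).Prime := by rw [hK2]; exact Nat.prime_two
  refine ⟨K, inferInstance, inferInstance, inferInstance, hK2, ?_⟩
  filter_upwards [hδK.eventually_isPrimitiveRoot_valueAtUniformizer hprime, hunrK] with v hroot hvK
  exact valueAtUniformizer_eq_quadraticSign_of_orderOf hK2 δ hvK hroot.eq_orderOf.symm

end CFT

/-! ### Satake self-twists on `GL_n` -/

section Helpers

variable {K : Type} [Field K] [NumberField K]

/-- `(χ ^ k)(ϖ_v) = χ(ϖ_v) ^ k`. [folklore] -/
private theorem valueAtUniformizer_pow_eq' (χ : HeckeCharacter K) (k : ℕ)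
    (v : HeightOneSpectrum (𝓞 K)) :
    (χ ^ k).valueAtUniformizer v = χ.valueAtUniformizer v ^ k := by
  simp only [HeckeCharacter.valueAtUniformizer, HeckeCharacter.localComponent_apply,
    HeckeCharacter.pow_apply, Units.val_pow_eq_pow_val]

/-- **A Satake self-twist character of an automorphic representation of `GL_n` is killed by `n`**:
if `ξ(ϖ_v) t_{π,v} = t_{π,v}` for almost all `v` then `ξ ^ n = 1`. Taking the product of the
`n` Satake eigenvalues (non-zero, `hasSatakeParamAt_ne_zero_holds`) at the almost all places where
`π` is unramified (`AutomorphicRepData.hasSatakeParamAt_cofinite_holds`) gives `ξ(ϖ_v)ⁿ = 1` a.e.,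
and a Hecke character trivial at almost all uniformizers is trivial
(`HeckeCharacter.eq_one_of_eventually_valueAtUniformizer_eq_one`). [folklore] -/
theorem pow_eq_one_of_satake_selfTwist {n : ℕ} {hcpt : isCompact_glFiniteIntegralLevel n K}
    (π : AutomorphicRepData (AutomorphyDatum.gl n K hcpt)) (ξ : HeckeCharacter K)
    (hξ : ∀ᶠ v : HeightOneSpectrum (𝓞 K) in cofinite, ∀ α : Multiset ℂ, π.HasSatakeParamAt v α →
      α.map (fun a => ξ.valueAtUniformizer v * a) = α) :
    ξ ^ n = 1 := by
  refine HeckeCharacter.eq_one_of_eventually_valueAtUniformizer_eq_one ?_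
  have hcof : ∀ᶠ v : HeightOneSpectrum (𝓞 K) in cofinite, π.IsUnramifiedAt v :=
    π.hasSatakeParamAt_cofinite_holds
  filter_upwards [hξ, hcof] with v hv hunr
  obtain ⟨α, hα⟩ := hunr
  have hprod := congrArg Multiset.prod (hv α hα)
  rw [prod_map_const_mul_eq, hα.card_eq] at hprod
  have hne : α.prod ≠ 0 :=
    Multiset.prod_ne_zero fun h0 => hasSatakeParamAt_ne_zero_holds hα 0 h0 rfl
  rw [valueAtUniformizer_pow_eq']
  exact mul_right_cancel₀ hne (hprod.trans (one_mul _).symm)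

/-- **A quadratic Satake self-twist comes from a quadratic field** (any `GL_n`). If a Hecke character
`δ` with `δ² = 1`, `δ ≠ 1` satisfies `δ(ϖ_v) t_{π,v} = t_{π,v}` for almost all `v`, then for the
quadratic extension `L/K` cut out by `δ` (global CFT for quadratic characters) the Satake
parameters of `π` are stable under the quadratic sign `ε_{L/K}(v)` (`+1` if some place of `L` over
`v` has residue degree `1`, `-1` otherwise) at almost every `v`, because `δ(ϖ_v) = ε_{L/K}(v)` a.e.
(`exists_quadratic_eventually_valueAtUniformizer_eq_quadraticSign`). Same argument as the tree's
`IsSatakeSelfTwist.exists_isQuadraticSelfTwistAE` (`GL₂`).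
[cite: ArthurClozelAMS120, Ch. 3, proof of Thm. 3.1 (p. 172)] -/
theorem exists_quadratic_sign_stable_of_satake_selfTwist {n : ℕ}
    {hcpt : isCompact_glFiniteIntegralLevel n K}
    (π : AutomorphicRepData (AutomorphyDatum.gl n K hcpt)) (δ : HeckeCharacter K)
    (hδ2 : δ ^ 2 = 1) (hδ1 : δ ≠ 1)
    (hδ : ∀ᶠ v : HeightOneSpectrum (𝓞 K) in cofinite, ∀ α : Multiset ℂ, π.HasSatakeParamAt v α →
      α.map (fun a => δ.valueAtUniformizer v * a) = α) :
    ∃ (L' : Type) (_ : Field L') (_ : NumberField L') (_ : Algebra K L'), Module.finrank K L' = 2 ∧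
      ∀ᶠ v : HeightOneSpectrum (𝓞 K) in cofinite, ∀ α : Multiset ℂ, π.HasSatakeParamAt v α →
        α.map (fun a => (if ∃ w : HeightOneSpectrum (𝓞 L'),
          w.asIdeal.under (𝓞 K) = v.asIdeal ∧ w.asIdeal.inertiaDeg (𝓞 K) = 1
            then (1 : ℂ) else -1) * a) = α := by
  obtain ⟨L, _, _, _, hL2, hδL⟩ :=
    exists_quadratic_eventually_valueAtUniformizer_eq_quadraticSign δ hδ2 hδ1
  refine ⟨L, inferInstance, inferInstance, inferInstance, hL2, ?_⟩
  filter_upwards [hδ, hδL] with v hv hsign α hα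
  have h := hv α hα
  rw [hsign] at h
  exact h

end Helpers

/-- **STUB W — the cuspidal exterior square (Asgari–Raghuram, contrapositive Satake form).** For `π`
cuspidal on `GL₄(𝔸_K)`, granting `AsgariRaghuram2007_selfDual_or_selfTwist_of_wedgeTwo_not_cuspidal`:
if `π` is NOT essentially self-dual (no `GL(1)` datum `η` with `t_{π,v}⁻¹ = η_v t_{π,v}` a.e.) and NOT
quadratically self-twisted (no quadratic `L'/K` with `t_{π,v}` stable under `ε_{L'/K}(v)` a.e.), then
there is a cuspidal `P6` on `GL₆(𝔸_K)` with `t_{P6,v} = ∧² t_{π,v}` a.e. Disjunct (α) of the named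
fact is refuted through the `GL(1)` datum of the Hecke character
(`exists_cuspidal_glOne_hasSatakeParamAt_valueAtUniformizer`); disjunct (β) through `ξ⁴ = 1`
(`pow_eq_one_of_satake_selfTwist`), the quadratic character `ξ` or `ξ²`, and CFT
(`exists_quadratic_sign_stable_of_satake_selfTwist`).
[cite: AsgariRaghuram2007, Theorem 1 (i) ⇒ (iii)] -/
theorem stub_wedgeTwoCuspidal :
    ∀ (K : Type) [Field K] [NumberField K]
      (h1 : Literature.NumberTheory.Automorphic.isCompact_glFiniteIntegralLevel 1 K)
      (hcpt : Literature.NumberTheory.Automorphic.isCompact_glFiniteIntegralLevel 4 K)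
      (h6 : Literature.NumberTheory.Automorphic.isCompact_glFiniteIntegralLevel 6 K)
      (π : Literature.NumberTheory.Automorphic.CuspidalAutomorphicRepData 4 K hcpt),
      Literature.NumberTheory.Automorphic.AsgariRaghuram2007_selfDual_or_selfTwist_of_wedgeTwo_not_cuspidal →
      ¬ (∃ η : Literature.NumberTheory.Automorphic.CuspidalAutomorphicRepData 1 K h1,
          ∀ᶠ v in Filter.cofinite, ∀ α : Multiset ℂ, π.1.HasSatakeParamAt v α →
            ∃ e : ℂ, η.1.HasSatakeParamAt v {e} ∧ α.map (fun a => a⁻¹) = α.map (fun a => e * a)) →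
      ¬ (∃ (L' : Type) (_ : Field L') (_ : NumberField L') (_ : Algebra K L'), Module.finrank K L' = 2 ∧
          ∀ᶠ v : IsDedekindDomain.HeightOneSpectrum (NumberField.RingOfIntegers K) in Filter.cofinite,
            ∀ α : Multiset ℂ, π.1.HasSatakeParamAt v α →
              α.map (fun a => (if ∃ w : IsDedekindDomain.HeightOneSpectrum (NumberField.RingOfIntegers L'),
                w.asIdeal.under (NumberField.RingOfIntegers K) = v.asIdeal ∧
                  w.asIdeal.inertiaDeg (NumberField.RingOfIntegers K) = 1 then (1 : ℂ) else -1) * a) = α) →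
      ∃ P6 : Literature.NumberTheory.Automorphic.CuspidalAutomorphicRepData 6 K h6,
        ∀ᶠ v : IsDedekindDomain.HeightOneSpectrum (NumberField.RingOfIntegers K) in Filter.cofinite,
          ∀ α : Multiset ℂ, π.1.HasSatakeParamAt v α →
            P6.1.HasSatakeParamAt v (Literature.NumberTheory.Automorphic.wedgeTwoParams α) := by
  intro K _ _ h1 hcpt h6 π hAR hnsd hnst
  -- the standing compactness facts, all levels at once (`hF 4 = hcpt`, `hF 6 = h6` by proof irrelevance)
  have hF : ∀ m : ℕ, isCompact_glFiniteIntegralLevel m K :=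
    fun m => isCompact_glFiniteIntegralLevel_holds m K
  by_contra hno
  have hno' : ¬ ∃ S : CuspidalAutomorphicRepData 6 K (hF 6),
      ∀ᶠ v : HeightOneSpectrum (𝓞 K) in cofinite, ∀ α : Multiset ℂ,
        π.1.HasSatakeParamAt v α → S.1.HasSatakeParamAt v (wedgeTwoParams α) :=
    fun ⟨S, hS⟩ => hno ⟨S, hS⟩
  rcases hAR K hF π hno' with ⟨χ, hχ⟩ | ⟨ξ, hξ1, hξ⟩
  · -- (α): essential self-duality through the `GL(1)` datum of `χ`
    obtain ⟨η, hη⟩ := exists_cuspidal_glOne_hasSatakeParamAt_valueAtUniformizer h1 χ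
    refine hnsd ⟨η, ?_⟩
    filter_upwards [hχ, hη] with v hv hηv α hα
    exact ⟨_, hηv, hv α hα⟩
  · -- (β): `ξ⁴ = 1`, so `ξ` or `ξ²` is quadratic and non-trivial, hence a quadratic sign
    have hξ4 : ξ ^ 4 = 1 := pow_eq_one_of_satake_selfTwist π.1 ξ hξ
    by_cases hξ2 : ξ ^ 2 = 1
    · obtain ⟨L, iL, iL', iA, hL2, hL⟩ :=
        exists_quadratic_sign_stable_of_satake_selfTwist π.1 ξ hξ2 hξ1 hξ
      exact hnst ⟨L, iL, iL', iA, hL2, hL⟩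
    · have hsq : (ξ ^ 2) ^ 2 = 1 := by rw [← pow_mul]; exact hξ4
      have hξξ : ∀ᶠ v : HeightOneSpectrum (𝓞 K) in cofinite, ∀ α : Multiset ℂ,
          π.1.HasSatakeParamAt v α → α.map (fun a => (ξ ^ 2).valueAtUniformizer v * a) = α := by
        filter_upwards [hξ] with v hv α hα
        have h := hv α hα
        calc α.map (fun a => (ξ ^ 2).valueAtUniformizer v * a)
            = (α.map (fun a => ξ.valueAtUniformizer v * a)).map
                (fun a => ξ.valueAtUniformizer v * a) := by
              rw [Multiset.map_map]
              congr 1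
              funext a
              simp only [Function.comp_apply]
              rw [valueAtUniformizer_pow_eq', pow_two, mul_assoc]
          _ = α := by rw [h, h]
      obtain ⟨L, iL, iL', iA, hL2, hL⟩ :=
        exists_quadratic_sign_stable_of_satake_selfTwist π.1 (ξ ^ 2) hsq hξ2 hξξ
      exact hnst ⟨L, iL, iL', iA, hL2, hL⟩

end Summit.Langlands.Langlands.Cruxes.ReducibleInducesSquare.Sketch

end
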